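import Literature.MathematicalPhysics.QuantumFieldTheory.Balaban1983to89.Node00.TorusCoverLandau153RecBlocks
import Literature.MathematicalPhysics.QuantumFieldTheory.Balaban1983to89.Node00.TorusCoverLandau153InGauge

/-!
# NODE 00 ↔ N05-REC — [Balaban1985Variational] (153) AT THE RECORD'S TORUS FROM THE TWIN'S CENTRED LANDAU DATUM `IsLandau138Z`, REAL TEST FUNCTIONS AND EVERY `μ ∈ N(Q′_D)`

Cell `pub-ymgap`, width seat `pub-ymgap-dag-n07-w3` generation 9 (N05-REC road item R7 = the NODE 00 bridge, LEAD PEN `dag-n05-e`), FILE 44.  NEW leaf, PROOF kind (no `def`, no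
`instance`, no `notation`).  CONSUMED BY NAME, nothing modified: this seat's FILE 43 `Node00.TorusCoverLandau153RecBlocks` (`sum_laplace_mul_diverg_eq_zero_of_isLandau138Z_cover`,
`indicator_coverShift_eq_zero_of_inGauge`, `sum_blockSitesZ_indicator_coverShift_eq_zero_of_inGauge`), generation 2's `Node00.TorusCoverLandau153InGauge` (`support_row_of_inGauge`),
dag-n07-e's `Node00.TorusCoverLevels` (`coverAt`), lit-balaban p21's `B6SectADomainsV1` (`Domains`, `Deep`, `LamSite`, `InGauge`), n05-d's `B8Eq138LandauZdRec.IsLandau138Z`,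
n05-e's `BlockAveragingZd.ctrShift`, `B7SectEFLinearisationRec.blockSitesZ`.  `--kind proof --supports stmt-QuantumFields-20541` (K0⁷; count-neutral).
[15] = [Balaban1985Variational]; [B6] = [Balaban1984PropagatorsII].

WHY.  FILE 43 proves [15] (153) ∕ [B6] (2.12) «`⟨Δμ, ∂*a⟩ = 0`» on the torus of record from the N05-REC twin's CENTRED multiplier-form Landau datum `IsLandau138Z L m η Ω₀ Λs 1 A″`
read through a translate `t` (the top-anchored lift of R7: `t = ctrShift L k·𝟙`), for COMPLEX test functions `μ` with three displayed rows (support; zero on the shifted lift of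
`Λs 0`; zero CENTRED block sums `Σ_{x ∈ blockSitesZ (Lʲ) y} 𝟙_X μ(π(x + t))`).  The door's consumers (`B6SectAOperatorsV1.RE`, entrywise currency) want REAL `μ : T → ℝ` and the real
bond functions `Re(φ∘A)`, `Im(φ∘A)` — generation 2's `Node00.TorusCoverLandau153InGauge` in the ORIGINAL (label-block) currency.  THIS FILE is its twin-currency counterpart:
§1 the real-test-function forms (cast bookkeeping only, pattern `Node00.TorusCoverLandau153TestForm` §3); §2 the rows supplied from `D.InGauge μ` ([B6] (2.7)) for any nested family
`D : Domains P` under the top-anchored STRUCTURAL rows (C0) every fine site inside `Ω₁` is the cover of a point of `S`; (C1′) for `x ∈ Λs 0` with `x + c_k ∈ X`: `π(x + c_k) ∈ Λ₀`;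
(Cj′) for `1 ≤ j ≤ m`, `y ∈ Λs j`: `π_j(y + c_{k−j}) ∈ Λ_j` and `blockSites (Lʲ) (y + c_{k−j}) ⊆ X` (`c_i := ctrShift L i·𝟙`, `m ≤ k`; FILE 43 §1: `blockSitesZ (Lʲ) y + c_k =
blockSites (Lʲ) (y + c_{k−j})`).

CONTENTS.  §1 `sum_laplace_mul_diverg_eq_zero_of_isLandau138Z_cover_real`, ★ `sum_laplace_mul_diverg_re_eq_zero_of_isLandau138Z_cover` ∕ `…_im_…`.
§2 ★★ `sum_laplace_mul_diverg_re_eq_zero_of_isLandau138Z_inGauge` ∕ `…_im_…`.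

HONEST FRAMING: compositions by name and `Re ∕ Im` bookkeeping; the structural rows (C0)(C1′)(Cj′) are DISPLAYED hypotheses (their discharge for the twin's cube datum is a separate
geometry item once that datum is in the tree); the last inch to `RE D c (dsE c a) = 0` is `RE_eq_zero_iff` + `inner_eq_sum` (consumer's line); nothing of [15] ∕ [6] ∕ [B6] analysis
asserted; `HThm4Rec` ∕ `HThm4RecEx` UNDISCHARGED; N07 ∕ N05 ∕ K0⁷ ∕ K1⁹ NOT closed or discharged; counts unmoved; one finite 𝕋⁴ programme at fixed ε — R4 closes the conditional
finite-𝕋⁴ rung `BalabanLadder.UV` only; the YM mass gap (Clay) is NOT proved by any of this; nothing continuum ∕ ℝ⁴ ∕ infinite volume ∕ OS.  No `sorry`, no `def`, no `instance`,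
no `notation`.
-/

noncomputable section

namespace Literature.MathematicalPhysics.QuantumFieldTheory.Balaban1983to89.Node00

open scoped BigOperators Matrix.Norms.L2Operator
open B15Eq112TorusCover (cover)
open B14DomainGeom (Pt)
open BlockAveragingZd (ctrShift)
open B7SectEFLinearisationRec (blockSitesZ)
open B8Eq138LandauZdRec (IsLandau138Z)
open Literature.MathematicalPhysics.QuantumLattice (blockSites)
open LatticeFieldCalculus (laplace diverg)
open B6SectADomainsV1 (Domains)

variable {P : Params}

variable {𝔸 : Type*} [NormedRing 𝔸] [NormedAlgebra ℂ 𝔸] [CompleteSpace 𝔸]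

/-! ## §1  Real test functions: the complex form, real part, imaginary part -/

section Real

/-- **(153) on the torus from `IsLandau138Z`, REAL test function, complex form**: FILE 43's `sum_laplace_mul_diverg_eq_zero_of_isLandau138Z_cover` for `μ : T → ℝ` cast to `ℂ`:
`Σ_y (laplace η⁻¹ μ)(y)·φ((diverg η⁻¹ A)(y)) = 0`, the rows stated for the cast `z ↦ (μ(π z) : ℂ)` (the currency of FILE 43 §1's suppliers).
[cite: Balaban1985Variational, (153) p.301; Balaban1984PropagatorsII, (2.8) p.224, (2.12) p.225] -/
theorem sum_laplace_mul_diverg_eq_zero_of_isLandau138Z_cover_real {L m : ℕ} (hL : Odd L) {η : ℝ} {Ω₀ : Set (Pt P.d)} (hΩ : Ω₀.Finite)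
    {Λs : ℕ → Set (Pt P.d)} {A'' : Pt P.d → Fin P.d → 𝔸}
    (hLan : IsLandau138Z L m η Ω₀ Λs (1 : B7Prop1Explicit.Site P.d → Fin P.d → 𝔸ˣ) A'') (t : Pt P.d)
    {X : Set (Pt P.d)} (hXΩ : X ⊆ (fun y => y + t) '' Ω₀) (hinj : Set.InjOn (cover P) X)
    {A : PBond P 0 → 𝔸} (hA : ∀ z, z ∈ X → ∀ κ, A ⟨cover P z, κ⟩ = A'' (z - t) κ)
    {μ : SiteField P 0 ℝ} {S : Set (Pt P.d)} (hμS : ∀ y, μ y ≠ 0 → y ∈ cover P '' S)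
    (hS : ∀ s ∈ S, ∀ z : Pt P.d, (∀ i, |z i - s i| ≤ 2) → z ∈ X)
    (h0 : ∀ x ∈ Λs 0, X.indicator (fun z => ((μ (cover P z) : ℝ) : ℂ)) (x + t) = 0)
    (hQ : ∀ j, 1 ≤ j → j ≤ m → ∀ y ∈ Λs j, ∑ x ∈ blockSitesZ (L ^ j) y, X.indicator (fun z => ((μ (cover P z) : ℝ) : ℂ)) (x + t) = 0)
    (φ : 𝔸 →L[ℂ] ℂ) :
    ∑ y : Site P 0, ((laplace η⁻¹ μ y : ℝ) : ℂ) * φ (diverg η⁻¹ A y) = 0 := by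
  have hC := sum_laplace_mul_diverg_eq_zero_of_isLandau138Z_cover hL hΩ hLan t hXΩ hinj hA (μ := fun y => (μ y : ℂ)) (S := S)
    (fun y hy => hμS y (by simpa using hy)) hS h0 hQ φ
  have hlap : ∀ y, laplace η⁻¹ (fun y => (μ y : ℂ)) y = ((laplace η⁻¹ μ y : ℝ) : ℂ) := fun y => by
    simp only [laplace, smul_eq_mul, Complex.real_smul, Complex.ofReal_sum, Complex.ofReal_mul, Complex.ofReal_pow, Complex.ofReal_inv,
      Complex.ofReal_sub, Complex.ofReal_add]
  simpa only [hlap] using hC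

/-- ★ **(153) on the torus from `IsLandau138Z`, REAL PART** (entrywise currency): for a real torus test function `μ : T → ℝ` with the three rows of FILE 43 (cast to `ℂ`) and every
`φ : 𝔸 →L[ℂ] ℂ`, the real bond function `a := Re(φ ∘ A)` satisfies `Σ_y (laplace η⁻¹ μ)(y)·(diverg η⁻¹ a)(y) = 0` — `⟨Δμ, ∂*a⟩ = 0` in the `ℓ²` pairing of
`B6SectAOperatorsV1.inner_eq_sum`.  [cite: Balaban1985Variational, (153) p.301; Balaban1984PropagatorsII, (2.8) p.224, (2.12) p.225] -/
theorem sum_laplace_mul_diverg_re_eq_zero_of_isLandau138Z_cover {L m : ℕ} (hL : Odd L) {η : ℝ} {Ω₀ : Set (Pt P.d)} (hΩ : Ω₀.Finite)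
    {Λs : ℕ → Set (Pt P.d)} {A'' : Pt P.d → Fin P.d → 𝔸}
    (hLan : IsLandau138Z L m η Ω₀ Λs (1 : B7Prop1Explicit.Site P.d → Fin P.d → 𝔸ˣ) A'') (t : Pt P.d)
    {X : Set (Pt P.d)} (hXΩ : X ⊆ (fun y => y + t) '' Ω₀) (hinj : Set.InjOn (cover P) X)
    {A : PBond P 0 → 𝔸} (hA : ∀ z, z ∈ X → ∀ κ, A ⟨cover P z, κ⟩ = A'' (z - t) κ)
    {μ : SiteField P 0 ℝ} {S : Set (Pt P.d)} (hμS : ∀ y, μ y ≠ 0 → y ∈ cover P '' S)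
    (hS : ∀ s ∈ S, ∀ z : Pt P.d, (∀ i, |z i - s i| ≤ 2) → z ∈ X)
    (h0 : ∀ x ∈ Λs 0, X.indicator (fun z => ((μ (cover P z) : ℝ) : ℂ)) (x + t) = 0)
    (hQ : ∀ j, 1 ≤ j → j ≤ m → ∀ y ∈ Λs j, ∑ x ∈ blockSitesZ (L ^ j) y, X.indicator (fun z => ((μ (cover P z) : ℝ) : ℂ)) (x + t) = 0)
    (φ : 𝔸 →L[ℂ] ℂ) :
    ∑ y : Site P 0, laplace η⁻¹ μ y * diverg η⁻¹ (fun b => (φ (A b)).re) y = 0 := by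
  have hC := sum_laplace_mul_diverg_eq_zero_of_isLandau138Z_cover_real hL hΩ hLan t hXΩ hinj hA hμS hS h0 hQ φ
  have hdiv : ∀ y, (φ (diverg η⁻¹ A y)).re = diverg η⁻¹ (fun b => (φ (A b)).re) y := fun y => by
    simp only [diverg, map_sum, φ.map_smul_of_tower, map_sub, Complex.re_sum, Complex.smul_re, Complex.sub_re]
  have := congrArg Complex.re hC
  rw [Complex.re_sum, Complex.zero_re] at this
  simpa only [Complex.re_ofReal_mul, hdiv] using this

/-- ★ **(153) on the torus from `IsLandau138Z`, IMAGINARY PART**: the same for `a := Im(φ ∘ A)`.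
[cite: Balaban1985Variational, (153) p.301; Balaban1984PropagatorsII, (2.8) p.224, (2.12) p.225] -/
theorem sum_laplace_mul_diverg_im_eq_zero_of_isLandau138Z_cover {L m : ℕ} (hL : Odd L) {η : ℝ} {Ω₀ : Set (Pt P.d)} (hΩ : Ω₀.Finite)
    {Λs : ℕ → Set (Pt P.d)} {A'' : Pt P.d → Fin P.d → 𝔸}
    (hLan : IsLandau138Z L m η Ω₀ Λs (1 : B7Prop1Explicit.Site P.d → Fin P.d → 𝔸ˣ) A'') (t : Pt P.d)
    {X : Set (Pt P.d)} (hXΩ : X ⊆ (fun y => y + t) '' Ω₀) (hinj : Set.InjOn (cover P) X)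
    {A : PBond P 0 → 𝔸} (hA : ∀ z, z ∈ X → ∀ κ, A ⟨cover P z, κ⟩ = A'' (z - t) κ)
    {μ : SiteField P 0 ℝ} {S : Set (Pt P.d)} (hμS : ∀ y, μ y ≠ 0 → y ∈ cover P '' S)
    (hS : ∀ s ∈ S, ∀ z : Pt P.d, (∀ i, |z i - s i| ≤ 2) → z ∈ X)
    (h0 : ∀ x ∈ Λs 0, X.indicator (fun z => ((μ (cover P z) : ℝ) : ℂ)) (x + t) = 0)
    (hQ : ∀ j, 1 ≤ j → j ≤ m → ∀ y ∈ Λs j, ∑ x ∈ blockSitesZ (L ^ j) y, X.indicator (fun z => ((μ (cover P z) : ℝ) : ℂ)) (x + t) = 0)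
    (φ : 𝔸 →L[ℂ] ℂ) :
    ∑ y : Site P 0, laplace η⁻¹ μ y * diverg η⁻¹ (fun b => (φ (A b)).im) y = 0 := by
  have hC := sum_laplace_mul_diverg_eq_zero_of_isLandau138Z_cover_real hL hΩ hLan t hXΩ hinj hA hμS hS h0 hQ φ
  have hdiv : ∀ y, (φ (diverg η⁻¹ A y)).im = diverg η⁻¹ (fun b => (φ (A b)).im) y := fun y => by
    simp only [diverg, map_sum, φ.map_smul_of_tower, map_sub, Complex.im_sum, Complex.smul_im, Complex.sub_im]
  have := congrArg Complex.im hC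
  rw [Complex.im_sum, Complex.zero_im] at this
  simpa only [Complex.im_ofReal_mul, hdiv] using this

end Real

/-! ## §2  ★★ (153) on the torus from `IsLandau138Z` for every `μ ∈ N(Q′_D)` — top-anchored structural rows -/

section InGauge

/-- ★★ **[15] (153) ∕ [B6] (2.12) AT THE RECORD'S TORUS FROM THE TWIN'S DATUM, FOR EVERY `μ ∈ N(Q′_D)`, REAL PART.**  Setting: the N05-REC twin's centred multiplier-form Landau
datum `IsLandau138Z P.L m η Ω₀ Λs 1 A″` on `ℤᵈ`, read on the torus through the top-anchored translate `c_k = ctrShift L k·𝟙` (`m ≤ k`): a window `X ⊆ Ω₀ + c_k` on which `π` is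
injective and the torus potential is `A⟨π z, κ⟩ = A″(z − c_k) κ`, a set `S` two steps inside `X`; a nested family `D : Domains P` ([B6] (2.1)–(2.4)) tied to `(Λs, X, S)` by the
structural rows (C0) every fine site inside `Ω₁` is the cover of a point of `S`; (C1′) for `x ∈ Λs 0` with `x + c_k ∈ X`: `π(x + c_k) ∈ Λ₀`; (Cj′) for `1 ≤ j ≤ m`, `y ∈ Λs j`:
`π_j(y + c_{k−j}) ∈ Λ_j` and `blockSites (Lʲ) (y + c_{k−j}) ⊆ X`.  Then for EVERY `μ` with `D.InGauge μ` ([B6] (2.7)) and every `φ : 𝔸 →L[ℂ] ℂ`: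
`Σ_y (laplace η⁻¹ μ)(y)·(diverg η⁻¹ (Re(φ∘A)))(y) = 0`.  The rows of §1 come from `Node00.TorusCoverLandau153InGauge.support_row_of_inGauge` and FILE 43 §1
(`indicator_coverShift_eq_zero_of_inGauge`, `sum_blockSitesZ_indicator_coverShift_eq_zero_of_inGauge`).
[cite: Balaban1985Variational, (153) p.301, p.302; Balaban1984PropagatorsII, (2.7) p.224, (2.10)–(2.12) p.225] -/
theorem sum_laplace_mul_diverg_re_eq_zero_of_isLandau138Z_inGauge {m k : ℕ} (hmk : m ≤ k) {η : ℝ} {Ω₀ : Set (Pt P.d)} (hΩ : Ω₀.Finite)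
    {Λs : ℕ → Set (Pt P.d)} {A'' : Pt P.d → Fin P.d → 𝔸}
    (hLan : IsLandau138Z P.L m η Ω₀ Λs (1 : B7Prop1Explicit.Site P.d → Fin P.d → 𝔸ˣ) A'')
    {X : Set (Pt P.d)} (hXΩ : X ⊆ (fun y => y + fun _ => ((ctrShift P.L k : ℕ) : ℤ)) '' Ω₀) (hinj : Set.InjOn (cover P) X)
    {A : PBond P 0 → 𝔸} (hA : ∀ z, z ∈ X → ∀ κ, A ⟨cover P z, κ⟩ = A'' (z - fun _ => ((ctrShift P.L k : ℕ) : ℤ)) κ)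
    {S : Set (Pt P.d)} (hS : ∀ s ∈ S, ∀ z : Pt P.d, (∀ i, |z i - s i| ≤ 2) → z ∈ X)
    (D : Domains P) (hC0 : ∀ y : Site P 0, D.Deep 0 y → y ∈ cover P '' S)
    (hC1 : ∀ x ∈ Λs 0, (x + fun _ => ((ctrShift P.L k : ℕ) : ℤ)) ∈ X → D.LamSite 0 (cover P (x + fun _ => ((ctrShift P.L k : ℕ) : ℤ))))
    (hCj : ∀ j, 1 ≤ j → j ≤ m → ∀ y ∈ Λs j, D.LamSite j (coverAt P j (y + fun _ => ((ctrShift P.L (k - j) : ℕ) : ℤ))) ∧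
      (↑(blockSites (P.L ^ j) (y + fun _ => ((ctrShift P.L (k - j) : ℕ) : ℤ))) : Set (Pt P.d)) ⊆ X)
    {μ : SiteField P 0 ℝ} (hμ : D.InGauge μ) (φ : 𝔸 →L[ℂ] ℂ) :
    ∑ y : Site P 0, laplace η⁻¹ μ y * diverg η⁻¹ (fun b => (φ (A b)).re) y = 0 :=
  sum_laplace_mul_diverg_re_eq_zero_of_isLandau138Z_cover P.hL.1 hΩ hLan _ hXΩ hinj hA (support_row_of_inGauge D hμ hC0) hS
    (fun x hx => by
      by_cases hxX : (x + fun _ => ((ctrShift P.L k : ℕ) : ℤ)) ∈ X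
      · exact indicator_coverShift_eq_zero_of_inGauge D hμ k (hC1 x hx hxX) X
      · exact Set.indicator_of_notMem hxX _)
    (fun j hj hjm y hy => sum_blockSitesZ_indicator_coverShift_eq_zero_of_inGauge D hμ (hjm.trans hmk) (hCj j hj hjm y hy).1 (hCj j hj hjm y hy).2) φ

/-- ★★ **The same, IMAGINARY PART** (`a = Im(φ∘A)`). [cite: Balaban1985Variational, (153) p.301; Balaban1984PropagatorsII, (2.7) p.224, (2.12) p.225] -/
theorem sum_laplace_mul_diverg_im_eq_zero_of_isLandau138Z_inGauge {m k : ℕ} (hmk : m ≤ k) {η : ℝ} {Ω₀ : Set (Pt P.d)} (hΩ : Ω₀.Finite)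
    {Λs : ℕ → Set (Pt P.d)} {A'' : Pt P.d → Fin P.d → 𝔸}
    (hLan : IsLandau138Z P.L m η Ω₀ Λs (1 : B7Prop1Explicit.Site P.d → Fin P.d → 𝔸ˣ) A'')
    {X : Set (Pt P.d)} (hXΩ : X ⊆ (fun y => y + fun _ => ((ctrShift P.L k : ℕ) : ℤ)) '' Ω₀) (hinj : Set.InjOn (cover P) X)
    {A : PBond P 0 → 𝔸} (hA : ∀ z, z ∈ X → ∀ κ, A ⟨cover P z, κ⟩ = A'' (z - fun _ => ((ctrShift P.L k : ℕ) : ℤ)) κ)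
    {S : Set (Pt P.d)} (hS : ∀ s ∈ S, ∀ z : Pt P.d, (∀ i, |z i - s i| ≤ 2) → z ∈ X)
    (D : Domains P) (hC0 : ∀ y : Site P 0, D.Deep 0 y → y ∈ cover P '' S)
    (hC1 : ∀ x ∈ Λs 0, (x + fun _ => ((ctrShift P.L k : ℕ) : ℤ)) ∈ X → D.LamSite 0 (cover P (x + fun _ => ((ctrShift P.L k : ℕ) : ℤ))))
    (hCj : ∀ j, 1 ≤ j → j ≤ m → ∀ y ∈ Λs j, D.LamSite j (coverAt P j (y + fun _ => ((ctrShift P.L (k - j) : ℕ) : ℤ))) ∧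
      (↑(blockSites (P.L ^ j) (y + fun _ => ((ctrShift P.L (k - j) : ℕ) : ℤ))) : Set (Pt P.d)) ⊆ X)
    {μ : SiteField P 0 ℝ} (hμ : D.InGauge μ) (φ : 𝔸 →L[ℂ] ℂ) :
    ∑ y : Site P 0, laplace η⁻¹ μ y * diverg η⁻¹ (fun b => (φ (A b)).im) y = 0 :=
  sum_laplace_mul_diverg_im_eq_zero_of_isLandau138Z_cover P.hL.1 hΩ hLan _ hXΩ hinj hA (support_row_of_inGauge D hμ hC0) hS
    (fun x hx => by
      by_cases hxX : (x + fun _ => ((ctrShift P.L k : ℕ) : ℤ)) ∈ X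
      · exact indicator_coverShift_eq_zero_of_inGauge D hμ k (hC1 x hx hxX) X
      · exact Set.indicator_of_notMem hxX _)
    (fun j hj hjm y hy => sum_blockSitesZ_indicator_coverShift_eq_zero_of_inGauge D hμ (hjm.trans hmk) (hCj j hj hjm y hy).1 (hCj j hj hjm y hy).2) φ

end InGauge

end Literature.MathematicalPhysics.QuantumFieldTheory.Balaban1983to89.Node00

end
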